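import Literature.MathematicalPhysics.QuantumFieldTheory.Balaban1983to89.B6SectAVectorModelV1
import Literature.MathematicalPhysics.QuantumFieldTheory.Balaban1983to89.B6SectA
import HarnessLib

/-!
# Route `UnitScaleTilt`, crux K1 «MinimiserStabilityRegPr» (stmt-QuantumFields-19200), leaf V2′ `stub_halvingStep` — branch (P2-small) «H-SMALL», mechanism (α)
# COVERING ∕ PERIODISATION (★★OWNER RULING g26-№18): **brick α4-CORE — THE FLAT OPERATORS `G = Δ_a⁻¹`, `QGQ*`, `(QGQ*)⁻¹`, `H = GQ*(QGQ*)⁻¹`, `G̃ = G − HQG`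
# INTERTWINE WITH ANY PAIR OF LINEAR MAPS THAT INTERTWINES THE LOCAL BLOCKS `Δ_a`, `Q`, `Q*`** (pure linear algebra: inverses of injective endomorphisms are unique)

Cell `ym3-torus` (HUMAN RULING D-0037, YM ladder rung R3 — continuum SU(2) YM₃ on the torus is a RUNG, not the Clay problem), width seat `ym-ust-19200-w5` gen 3
(LEAD (S3), H-SMALL planner).  `--supports stmt-QuantumFields-19200 --as helper`; def-free, 0 sorry, standard axioms.

THE POINT (memo `H-SMALL-PLAN-w5g3.md` = 19200 evidence #54, §3∕§5 k-i).  For a nested family `D` on the member's lattice `P` and its lift `D̃` to a covering lattice `P̃`,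
the pullbacks `πB : L²(bonds of P) → L²(bonds of P̃)`, `πI : L²(𝔅(D)) → L²(𝔅(D̃))` intertwine the LOCAL stencils (brick α3: `Δ_a`, `Q`, `Q*`).  This file shows,
ONCE AND ABSTRACTLY (any two families, any two linear maps `πB`, `πI`, the three intertwining relations as hypotheses), that then the NON-local operators of
[Balaban1984PropagatorsII] Sect. A intertwine as well — because each is the inverse of an injective endomorphism (✓`GE = (ofInjectiveEndo Δ_a)⁻¹`,
✓`EE = (ofInjectiveEndo QGQ*)⁻¹`) or a composite:
* `GE_intertwine` : `G̃E (πB u) = πB (GE u)`;  `qgqE_intertwine`;  `EE_intertwine` : `ẼE (πI ω) = πI (EE ω)`;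
* ★ `hOp_intertwine` : `H̃ (πI ω) = πB (H ω)` for `H = hOp G Q* E = GQ*(QGQ*)⁻¹` ((2.35));
* `Gt_intertwine` : `(G̃ − H̃Q̃G̃)(πB f) = πB ((G − HQG) f)` ((143)∕(158)'s `G̃ = G − HQG`).
Hence (bricks α3 + α5): the small member's CANONICAL operators pinned by `IsFlatH`∕`IsFlatGt` are the descents of the cover's, and every P2 letter transfers.
NOT a claim about the mass gap.

References: T. Bałaban, CMP **96** (1984) 223–250 [Balaban1984PropagatorsII] ((2.19)–(2.22) p.226, (2.35) p.228); CMP **102** (1985) 277–309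
[Balaban1985Variational] ((45) p.285, (143) p.300, (157)–(158) p.302).
-/

noncomputable section

namespace Summit.QuantumFields.YangMills.Theorems.CoverFlatOps

open Literature.MathematicalPhysics.QuantumFieldTheory.Balaban1983to89
open B6SectADomainsV1 (Domains)
open B6SectAOperatorsV1 (BondIdx BondIdxSpace QE QsE)
open B6SectAVectorModelV1 (deltaAE GE qgqE EE GE_deltaAE deltaAE_GE EE_comp comp_EE)
open B6SectA (hOp)
open Literature.MathematicalPhysics.QuantumFieldTheory.BalabanImbrieJaffe1984to88.BIJ85AxialPropagator411 (BondSpace)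

variable {P P' : Params} (D : Domains P) (D' : Domains P')
variable {c : ℝ} (hc : c ≠ 0) {w : BondIdx D → ℝ} (hw : ∀ i, 0 < w i) {w' : BondIdx D' → ℝ} (hw' : ∀ i, 0 < w' i)
variable (πB : BondSpace P →ₗ[ℝ] BondSpace P') (πI : BondIdxSpace D →ₗ[ℝ] BondIdxSpace D')

/-- **`G = Δ_a⁻¹` INTERTWINES** whenever `Δ_a` does: `G′(πB u) = πB(G u)`. [cite: Balaban1984PropagatorsII, (2.22) p.226] -/
theorem GE_intertwine (hΔ : ∀ u, deltaAE D' c w' (πB u) = πB (deltaAE D c w u)) (u : BondSpace P) :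
    GE D' hc hw' (πB u) = πB (GE D hc hw u) := by
  have h : deltaAE D' c w' (πB (GE D hc hw u)) = πB u := by rw [hΔ, deltaAE_GE]
  rw [← h, GE_deltaAE]

/-- **`QGQ*` INTERTWINES** whenever `Δ_a`, `Q`, `Q*` do. [cite: Balaban1984PropagatorsII, (2.35) p.228] -/
theorem qgqE_intertwine (hΔ : ∀ u, deltaAE D' c w' (πB u) = πB (deltaAE D c w u))
    (hQ : ∀ u, QE D' (πB u) = πI (QE D u)) (hQs : ∀ ω, QsE D' (πI ω) = πB (QsE D ω)) (ω : BondIdxSpace D) :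
    qgqE D' hc hw' (πI ω) = πI (qgqE D hc hw ω) := by
  simp only [B6SectAVectorModelV1.qgqE_def, LinearMap.coe_comp, Function.comp_apply]
  rw [hQs, GE_intertwine D D' hc hw hw' πB hΔ, hQ]

/-- **`(QGQ*)⁻¹` INTERTWINES** whenever `Δ_a`, `Q`, `Q*` do: `E′(πI ω) = πI(E ω)`. [cite: Balaban1984PropagatorsII, (2.35) p.228] -/
theorem EE_intertwine (hΔ : ∀ u, deltaAE D' c w' (πB u) = πB (deltaAE D c w u))
    (hQ : ∀ u, QE D' (πB u) = πI (QE D u)) (hQs : ∀ ω, QsE D' (πI ω) = πB (QsE D ω)) (ω : BondIdxSpace D) :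
    EE D' hc hw' (πI ω) = πI (EE D hc hw ω) := by
  -- `QGQ*′ (πI (E ω)) = πI (QGQ* (E ω)) = πI ω`, then apply `E′` and use `E′ ∘ QGQ*′ = 1`
  have h1 : qgqE D' hc hw' (πI (EE D hc hw ω)) = πI ω := by
    rw [qgqE_intertwine D D' hc hw hw' πB πI hΔ hQ hQs]
    have := LinearMap.congr_fun (comp_EE D hc hw) ω
    rw [LinearMap.comp_apply, LinearMap.id_apply] at this
    rw [B6SectAVectorModelV1.qgqE_def, this]
  have h2 := LinearMap.congr_fun (EE_comp D' hc hw') (πI (EE D hc hw ω))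
  rw [LinearMap.comp_apply, LinearMap.id_apply, ← B6SectAVectorModelV1.qgqE_def, h1] at h2
  exact h2

/-- ★ **`H = GQ*(QGQ*)⁻¹` INTERTWINES** whenever `Δ_a`, `Q`, `Q*` do: `H′(πI ω) = πB(H ω)` — the small member's (45)-operator is the descent of the cover's.
[cite: Balaban1984PropagatorsII, (2.35) p.228; Balaban1985Variational, (45) p.285, (157) p.302] -/
theorem hOp_intertwine (hΔ : ∀ u, deltaAE D' c w' (πB u) = πB (deltaAE D c w u))
    (hQ : ∀ u, QE D' (πB u) = πI (QE D u)) (hQs : ∀ ω, QsE D' (πI ω) = πB (QsE D ω)) (ω : BondIdxSpace D) :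
    hOp (GE D' hc hw') (QsE D') (EE D' hc hw') (πI ω) = πB (hOp (GE D hc hw) (QsE D) (EE D hc hw) ω) := by
  simp only [hOp, LinearMap.coe_comp, Function.comp_apply]
  rw [EE_intertwine D D' hc hw hw' πB πI hΔ hQ hQs, hQs, GE_intertwine D D' hc hw hw' πB hΔ]

/-- **`G̃ = G − HQG` INTERTWINES** whenever `Δ_a`, `Q`, `Q*` do. [cite: Balaban1985Variational, (143) p.300, (158) p.302] -/
theorem Gt_intertwine (hΔ : ∀ u, deltaAE D' c w' (πB u) = πB (deltaAE D c w u))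
    (hQ : ∀ u, QE D' (πB u) = πI (QE D u)) (hQs : ∀ ω, QsE D' (πI ω) = πB (QsE D ω)) (f : BondSpace P) :
    (GE D' hc hw' - hOp (GE D' hc hw') (QsE D') (EE D' hc hw') ∘ₗ QE D' ∘ₗ GE D' hc hw') (πB f) =
      πB ((GE D hc hw - hOp (GE D hc hw) (QsE D) (EE D hc hw) ∘ₗ QE D ∘ₗ GE D hc hw) f) := by
  simp only [LinearMap.sub_apply, LinearMap.coe_comp, Function.comp_apply, map_sub]
  rw [GE_intertwine D D' hc hw hw' πB hΔ, hQ, hOp_intertwine D D' hc hw hw' πB πI hΔ hQ hQs]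

/-- **THE INTERTWINING OF `Δ_a` REDUCES TO ITS THREE SUMMANDS** `∂*∂`, `∂R∂*`, `Q*aQ` ((2.19)): bookkeeping for brick α3, which proves the three separately
(the `R`-summand needs the pushforward∕adjoint argument, the other two are plain stencils). [cite: Balaban1984PropagatorsII, (2.19) p.226] -/
theorem deltaAE_intertwine_of_summands
    (h1 : ∀ u, (B6SectAOperatorsV1.dcsE c ∘ₗ B6SectAOperatorsV1.dcE c) (πB u) = πB ((B6SectAOperatorsV1.dcsE c ∘ₗ B6SectAOperatorsV1.dcE c) u))
    (h2 : ∀ u, (B6SectAOperatorsV1.dE c ∘ₗ B6SectAOperatorsV1.RE D' c ∘ₗ B6SectAOperatorsV1.dsE c) (πB u) =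
      πB ((B6SectAOperatorsV1.dE c ∘ₗ B6SectAOperatorsV1.RE D c ∘ₗ B6SectAOperatorsV1.dsE c) u))
    (h3 : ∀ u, (QsE D' ∘ₗ B6SectAOperatorsV1.aE D' w' ∘ₗ QE D') (πB u) = πB ((QsE D ∘ₗ B6SectAOperatorsV1.aE D w ∘ₗ QE D) u))
    (u : BondSpace P) : deltaAE D' c w' (πB u) = πB (deltaAE D c w u) := by
  rw [B6SectAVectorModelV1.deltaAE_def, B6SectAVectorModelV1.deltaAE_def, LinearMap.add_apply, LinearMap.add_apply, LinearMap.add_apply,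
    LinearMap.add_apply, map_add, map_add, h1, h2, h3]

end Summit.QuantumFields.YangMills.Theorems.CoverFlatOps

end
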